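import Summits.ValiantsHypothesis.ValiantsHypothesis.Theorems.LacunarySymmetroidMatrixDescartesCensusSignClass
import Summits.ValiantsHypothesis.ValiantsHypothesis.Theorems.LacunarySymmetroidMatrixDescartesCensusDefs

/-!
# `MatrixDescartes` census — CHAMBER-UNIFORM sign-class kill: the door-A row on every support of a parity-dead chamber

HONEST FRAMING.  Object-search cell `pub-symmetroid`, door-A target `DoorA26 := PosRootLawAt 2 6 19`
(stmt-ValiantsHypothesis-19979; OPEN, typed, never asserted), crux `Theses.LacunarySymmetroid.MatrixDescartes`
(stmt-ValiantsHypothesis-18050).  The tree's sign-class schema `Census.card_posRoots_add_two_le_of_signClass`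
(…CensusSignClass.lean; C22, layer 1: two «odd definite triangles», one per global sign) is a theorem about ONE exponent
vector `d` with decidable hypotheses, used so far support by support (`posRoots_le_19_on_2_6_0_2_5_11_18_28`).  Its
hypotheses depend only on the ORDER TYPE of the 21 pair sums `dᵢ + dⱼ` — the cell's CHAMBER (theory g6 CHAMBERS-2-6.md: the
2-Sidon supports of `(2,6)` fall into exactly 2 608 chambers = 1 304 mirror pairs).  This file discharges them from a
chamber order, for SYMBOLIC `d`:

* a chamber is given as data `σ : Fin 21 → Fin 6 × Fin 6` (the 21 unordered pairs in increasing order of their sums) and the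
  hypothesis `StrictMono ((fun p => d p.1 + d p.2) ∘ σ)` — 20 strict LINEAR inequalities in `d`, decidable on a concrete
  support via `Fin.strictMono_iff_lt_succ`;
* bookkeeping: `image_pairSum_eq_of_chamber`, `card_pairSums_of_chamber` (`= 21`: chamber supports are 2-Sidon),
  `pair_eq_of_chamber` (the `t`-th sum is attained only at its own pair), `card_filter_lt_of_chamber` (its rank is `t`);
* **`posRootLawOn_of_chamber_triangles`** — if both orientations of the chamber's `V = 20` sign pattern contain an odd
  definite triangle (read off the POSITIONS in `σ`: three diagonal positions even and the three pair positions of odd sum for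
  `s = +`; odd / even sum for `s = −` — decidable data, one `decide`), then `PosRootLawOn 2 6 19 d` for EVERY `d` in the
  chamber: no real symmetric `2 × 2` six-term pencil on ANY support of that chamber has `20 = D(2,6)` distinct positive
  det-roots;
* the first two instances, the mirror pair of chambers 1471 / 1615 of theory g6's table (smallest members
  `(0,5,8,15,17,21)` / `(0,4,6,13,16,21)`, just outside BOX20), and the decidable membership test on those two supports.

One chamber = infinitely many supports of all shapes (an open polyhedral cone of exponent vectors); the companion files
`…CensusChamberSignClass{A,B,C}.lean` instantiate the remaining chambers that are triangle-dead in both orientations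
(126 = 63 mirror pairs in all; none meets the box `d₅ − d₀ ≤ 20`).  This is the SIGN layer only: it says nothing about the
2 482 other chambers (where at least one orientation needs magnitude arguments or the L-pair/L-tri rules), about `V = 19`,
about `DoorA26` as a whole (OPEN), about the crux, or about `VP ≠ VNP`.

[folklore] Elementary bookkeeping over the cell's sign-class certificate; no citation exists or is needed.
-/

-- `Summit.ValiantsHypothesis.ValiantsHypothesis.…` repeats a component by the D-0017 layout
-- (single-conjunct summit), which the `dupNamespace` linter flags; the name is mandated.
set_option linter.dupNamespace false

namespace Summit.ValiantsHypothesis.ValiantsHypothesis.Theorems.LacunarySymmetroidMatrixDescartes.Census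

open Polynomial Finset
open scoped BigOperators Polynomial Matrix

/-! ## Chamber bookkeeping (symbolic exponents) -/

/-- In a chamber whose order `σ` covers all pairs, the set of pair sums is the image of the listed sequence. [folklore] -/
theorem image_pairSum_eq_of_chamber (σ : Fin 21 → Fin 6 × Fin 6)
    (hcov : ∀ p : Fin 6 × Fin 6, ∃ t : Fin 21, σ t = p ∨ σ t = p.swap) (d : Fin 6 → ℕ) :
    (univ : Finset (Fin 6 × Fin 6)).image (fun p => d p.1 + d p.2)
      = (univ : Finset (Fin 21)).image (fun t => d (σ t).1 + d (σ t).2) := by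
  ext e
  simp only [mem_image, mem_univ, true_and]
  constructor
  · rintro ⟨p, rfl⟩
    obtain ⟨t, ht | ht⟩ := hcov p
    · exact ⟨t, by rw [ht]⟩
    · exact ⟨t, by rw [ht, Prod.fst_swap, Prod.snd_swap, add_comm]⟩
  · rintro ⟨t, rfl⟩
    exact ⟨σ t, rfl⟩

/-- **A chamber support is 2-Sidon**: its pair-sum set has exactly `21` elements. [folklore] -/
theorem card_pairSums_of_chamber (σ : Fin 21 → Fin 6 × Fin 6)
    (hcov : ∀ p : Fin 6 × Fin 6, ∃ t : Fin 21, σ t = p ∨ σ t = p.swap) (d : Fin 6 → ℕ)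
    (hd : StrictMono ((fun p : Fin 6 × Fin 6 => d p.1 + d p.2) ∘ σ)) :
    ((univ : Finset (Fin 6 × Fin 6)).image (fun p => d p.1 + d p.2)).card = 21 := by
  have hinj : Function.Injective (fun t => d (σ t).1 + d (σ t).2) := hd.injective
  rw [image_pairSum_eq_of_chamber σ hcov d, card_image_of_injective _ hinj, card_univ, Fintype.card_fin]

/-- In a chamber the `t`-th listed sum is attained only at its own pair (up to swap). [folklore] -/
theorem pair_eq_of_chamber (σ : Fin 21 → Fin 6 × Fin 6)
    (hcov : ∀ p : Fin 6 × Fin 6, ∃ t : Fin 21, σ t = p ∨ σ t = p.swap) (d : Fin 6 → ℕ)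
    (hd : StrictMono ((fun p : Fin 6 × Fin 6 => d p.1 + d p.2) ∘ σ)) (t : Fin 21) (p : Fin 6 × Fin 6)
    (h : d p.1 + d p.2 = d (σ t).1 + d (σ t).2) : p = σ t ∨ p = (σ t).swap := by
  obtain ⟨u, hu | hu⟩ := hcov p
  · have hs : d (σ u).1 + d (σ u).2 = d (σ t).1 + d (σ t).2 := by rw [hu]; exact h
    have hut : u = t := hd.injective hs
    left; rw [← hu, hut]
  · have hs : d (σ u).1 + d (σ u).2 = d (σ t).1 + d (σ t).2 := by
      rw [hu, Prod.fst_swap, Prod.snd_swap, add_comm]; exact h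
    have hut : u = t := hd.injective hs
    subst hut
    right; rw [hu, Prod.swap_swap]

/-- In a chamber the `t`-th listed sum has exactly `t` pair sums below it (its rank is `t`). [folklore] -/
theorem card_filter_lt_of_chamber (σ : Fin 21 → Fin 6 × Fin 6)
    (hcov : ∀ p : Fin 6 × Fin 6, ∃ t : Fin 21, σ t = p ∨ σ t = p.swap) (d : Fin 6 → ℕ)
    (hd : StrictMono ((fun p : Fin 6 × Fin 6 => d p.1 + d p.2) ∘ σ)) (t : Fin 21) :
    (((univ : Finset (Fin 6 × Fin 6)).image (fun p => d p.1 + d p.2)).filter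
      (· < d (σ t).1 + d (σ t).2)).card = t := by
  rw [image_pairSum_eq_of_chamber σ hcov d, filter_image]
  have hset : (univ : Finset (Fin 21)).filter (fun u => d (σ u).1 + d (σ u).2 < d (σ t).1 + d (σ t).2)
      = Finset.Iio t := by
    ext u
    simp only [mem_filter, mem_univ, true_and, Finset.mem_Iio]
    exact hd.lt_iff_lt
  have hinj : Function.Injective (fun t => d (σ t).1 + d (σ t).2) := hd.injective
  rw [hset, card_image_of_injective _ hinj, Fin.card_Iio]

/-! ## The chamber-uniform sign-class theorem -/

/-- **CHAMBER-UNIFORM SIGN-CLASS KILL.**  Data: an order `σ` of the 21 pairs; letters `i₁ j₁ k₁` whose diagonal pairs sit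
at EVEN positions `a₁ b₁ c₁` of `σ` while their three mixed pairs sit at positions `e₁ f₁ g₁` of ODD sum (an odd definite
triangle for the global sign `s = +`), and letters `i₂ j₂ k₂` with ODD diagonal positions `a₂ b₂ c₂` and mixed positions
`e₂ f₂ g₂` of EVEN sum (an odd definite triangle for `s = −`); `σ` covers all pairs.  All of `hcert` is decidable.  Then
for EVERY exponent vector `d` in the chamber of `σ` (the listed sums strictly increase) the door-A row holds:
`ζ(2,6; d) ≤ 19` — no real symmetric `2 × 2` six-term pencil on `d` has `20 = D(2,6)` distinct positive det-roots.  Proof: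
the chamber order yields, for symbolic `d`, the hypotheses of `card_posRoots_add_two_le_of_signClass` (`21` distinct sums,
each listed sum attained only at its pair, rank of the `t`-th sum `= t`), whose conclusion is `#Z₊ + 2 ≤ 21`. [folklore] -/
theorem posRootLawOn_of_chamber_triangles (σ : Fin 21 → Fin 6 × Fin 6)
    (i₁ j₁ k₁ i₂ j₂ k₂ : Fin 6) (a₁ b₁ c₁ e₁ f₁ g₁ a₂ b₂ c₂ e₂ f₂ g₂ : Fin 21)
    (hcert : (∀ p : Fin 6 × Fin 6, ∃ t : Fin 21, σ t = p ∨ σ t = p.swap) ∧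
      (i₁ ≠ j₁ ∧ j₁ ≠ k₁ ∧ i₁ ≠ k₁ ∧ i₂ ≠ j₂ ∧ j₂ ≠ k₂ ∧ i₂ ≠ k₂) ∧
      (σ a₁ = (i₁, i₁) ∧ σ b₁ = (j₁, j₁) ∧ σ c₁ = (k₁, k₁) ∧ σ e₁ = (i₁, j₁) ∧ σ f₁ = (j₁, k₁) ∧ σ g₁ = (i₁, k₁)) ∧
      (σ a₂ = (i₂, i₂) ∧ σ b₂ = (j₂, j₂) ∧ σ c₂ = (k₂, k₂) ∧ σ e₂ = (i₂, j₂) ∧ σ f₂ = (j₂, k₂) ∧ σ g₂ = (i₂, k₂)) ∧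
      (Even (a₁ : ℕ) ∧ Even (b₁ : ℕ) ∧ Even (c₁ : ℕ) ∧ Odd ((e₁ : ℕ) + f₁ + g₁)) ∧
      (Odd (a₂ : ℕ) ∧ Odd (b₂ : ℕ) ∧ Odd (c₂ : ℕ) ∧ Even ((e₂ : ℕ) + f₂ + g₂)))
    (d : Fin 6 → ℕ) (hd : StrictMono ((fun p : Fin 6 × Fin 6 => d p.1 + d p.2) ∘ σ)) : PosRootLawOn 2 6 19 d := by
  obtain ⟨hcov, hne, ⟨ha₁, hb₁, hc₁, he₁, hf₁, hg₁⟩, ⟨ha₂, hb₂, hc₂, he₂, hf₂, hg₂⟩, ⟨pa₁, pb₁, pc₁, po₁⟩,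
    ⟨pa₂, pb₂, pc₂, pe₂⟩⟩ := hcert
  intro S hS
  -- every relevant exponent is a listed sum
  have hsum : ∀ {t : Fin 21} {i j : Fin 6}, σ t = (i, j) → d i + d j = d (σ t).1 + d (σ t).2 := by
    intro t i j ht; rw [ht]
  -- uniqueness of the twelve exponents
  have udiag : ∀ {t : Fin 21} {i : Fin 6}, σ t = (i, i) →
      ∀ p : Fin 6 × Fin 6, d p.1 + d p.2 = d i + d i → p = (i, i) := by
    intro t i ht p hp
    rw [hsum ht] at hp
    rcases pair_eq_of_chamber σ hcov d hd t p hp with h | h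
    · rw [h, ht]
    · rw [h, ht]; rfl
  have upair : ∀ {t : Fin 21} {i j : Fin 6}, σ t = (i, j) →
      ∀ p : Fin 6 × Fin 6, d p.1 + d p.2 = d i + d j → p = (i, j) ∨ p = (j, i) := by
    intro t i j ht p hp
    rw [hsum ht] at hp
    rcases pair_eq_of_chamber σ hcov d hd t p hp with h | h
    · left; rw [h, ht]
    · right; rw [h, ht]; rfl
  -- ranks of the twelve exponents
  have rk : ∀ {t : Fin 21} {i j : Fin 6}, σ t = (i, j) →
      (((univ : Finset (Fin 6 × Fin 6)).image (fun p => d p.1 + d p.2)).filter (· < d i + d j)).card = t := by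
    intro t i j ht
    rw [hsum ht]
    exact card_filter_lt_of_chamber σ hcov d hd t
  have h := card_posRoots_add_two_le_of_signClass d 21 (card_pairSums_of_chamber σ hcov d hd) i₁ j₁ k₁ i₂ j₂ k₂ hne
    (udiag ha₁) (udiag hb₁) (udiag hc₁) (upair he₁) (upair hf₁) (upair hg₁)
    (udiag ha₂) (udiag hb₂) (udiag hc₂) (upair he₂) (upair hf₂) (upair hg₂)
    (by
      simp only
      rw [rk ha₁, rk hb₁, rk hc₁, rk he₁, rk hf₁, rk hg₁]
      exact ⟨pa₁, pb₁, pc₁, po₁⟩)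
    (by
      simp only
      rw [rk ha₂, rk hb₂, rk hc₂, rk he₂, rk hf₂, rk hg₂]
      exact ⟨pa₂, pb₂, pc₂, pe₂⟩)
    S hS
  omega

/-- **Concrete-support form.**  The same conclusion for a support whose 20 consecutive listed-sum inequalities are checked
one by one (the form `decide` proves on a numeral support). [folklore] -/
theorem posRootLawOn_of_chamber_triangles' (σ : Fin 21 → Fin 6 × Fin 6)
    (i₁ j₁ k₁ i₂ j₂ k₂ : Fin 6) (a₁ b₁ c₁ e₁ f₁ g₁ a₂ b₂ c₂ e₂ f₂ g₂ : Fin 21)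
    (hcert : (∀ p : Fin 6 × Fin 6, ∃ t : Fin 21, σ t = p ∨ σ t = p.swap) ∧
      (i₁ ≠ j₁ ∧ j₁ ≠ k₁ ∧ i₁ ≠ k₁ ∧ i₂ ≠ j₂ ∧ j₂ ≠ k₂ ∧ i₂ ≠ k₂) ∧
      (σ a₁ = (i₁, i₁) ∧ σ b₁ = (j₁, j₁) ∧ σ c₁ = (k₁, k₁) ∧ σ e₁ = (i₁, j₁) ∧ σ f₁ = (j₁, k₁) ∧ σ g₁ = (i₁, k₁)) ∧
      (σ a₂ = (i₂, i₂) ∧ σ b₂ = (j₂, j₂) ∧ σ c₂ = (k₂, k₂) ∧ σ e₂ = (i₂, j₂) ∧ σ f₂ = (j₂, k₂) ∧ σ g₂ = (i₂, k₂)) ∧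
      (Even (a₁ : ℕ) ∧ Even (b₁ : ℕ) ∧ Even (c₁ : ℕ) ∧ Odd ((e₁ : ℕ) + f₁ + g₁)) ∧
      (Odd (a₂ : ℕ) ∧ Odd (b₂ : ℕ) ∧ Odd (c₂ : ℕ) ∧ Even ((e₂ : ℕ) + f₂ + g₂)))
    (d : Fin 6 → ℕ)
    (hd : ∀ t : Fin 20, d (σ t.castSucc).1 + d (σ t.castSucc).2 < d (σ t.succ).1 + d (σ t.succ).2) :
    PosRootLawOn 2 6 19 d :=
  posRootLawOn_of_chamber_triangles σ i₁ j₁ k₁ i₂ j₂ k₂ a₁ b₁ c₁ e₁ f₁ g₁ a₂ b₂ c₂ e₂ f₂ g₂ hcert d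
    (Fin.strictMono_iff_lt_succ.2 hd)

/-! ## First instances: the smallest parity-dead mirror pair (theory g6 ids 1471 / 1615, `min d₅ = 21`) -/

/-- **Door-A row on the whole chamber 1471** of theory g6's table (mirror 1615; smallest member
`(0,5,8,15,17,21)`; odd definite triangles `{0,2,5}` for `s = +`, `{1,3,4}` for `s = −`): every
exponent vector whose 21 pair sums are ordered this way has `ζ(2,6; d) ≤ 19`. [folklore] -/
theorem doorA26_on_chamber1471 (d : Fin 6 → ℕ)
    (hd : StrictMono ((fun p : Fin 6 × Fin 6 => d p.1 + d p.2) ∘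
      ![(0, 0), (0, 1), (0, 2), (1, 1), (1, 2), (0, 3), (2, 2), (0, 4), (1, 3), (0, 5), (1, 4),
        (2, 3), (2, 4), (1, 5), (2, 5), (3, 3), (3, 4), (4, 4), (3, 5), (4, 5), (5, 5)])) :
    PosRootLawOn 2 6 19 d :=
  posRootLawOn_of_chamber_triangles _ 0 2 5 1 3 4 0 6 20 2 14 9 3 15 17 8 16 10 (by decide) d hd

/-- **Door-A row on the whole chamber 1615** of theory g6's table (mirror 1471; smallest member
`(0,4,6,13,16,21)`; odd definite triangles `{0,3,5}` for `s = +`, `{1,2,4}` for `s = −`): every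
exponent vector whose 21 pair sums are ordered this way has `ζ(2,6; d) ≤ 19`. [folklore] -/
theorem doorA26_on_chamber1615 (d : Fin 6 → ℕ)
    (hd : StrictMono ((fun p : Fin 6 × Fin 6 => d p.1 + d p.2) ∘
      ![(0, 0), (0, 1), (0, 2), (1, 1), (1, 2), (2, 2), (0, 3), (0, 4), (1, 3), (2, 3), (1, 4),
        (0, 5), (2, 4), (1, 5), (3, 3), (2, 5), (3, 4), (4, 4), (3, 5), (4, 5), (5, 5)])) :
    PosRootLawOn 2 6 19 d :=
  posRootLawOn_of_chamber_triangles _ 0 3 5 1 2 4 0 14 20 6 18 11 3 5 17 4 12 10 (by decide) d hd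

/-- The smallest support of chamber 1471, `(0,5,8,15,17,21)`, by the decidable membership test
(20 numeral inequalities). [folklore] -/
example : PosRootLawOn 2 6 19 (![0, 5, 8, 15, 17, 21] : Fin 6 → ℕ) :=
  doorA26_on_chamber1471 _ (Fin.strictMono_iff_lt_succ.2 (by decide))

/-- The smallest support of chamber 1615, `(0,4,6,13,16,21)`, by the decidable membership test
(20 numeral inequalities). [folklore] -/
example : PosRootLawOn 2 6 19 (![0, 4, 6, 13, 16, 21] : Fin 6 → ℕ) :=
  doorA26_on_chamber1615 _ (Fin.strictMono_iff_lt_succ.2 (by decide))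

end Summit.ValiantsHypothesis.ValiantsHypothesis.Theorems.LacunarySymmetroidMatrixDescartes.Census
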